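import Summits.ValiantsHypothesis.ValiantsHypothesis.Theorems.LacunarySymmetroidMatrixDescartesCensusPivotIndexOneRoots

/-!
# `MatrixDescartes` (stmt-ValiantsHypothesis-18050) — INDEX-ONE MONOTONE-WINDOW LAW (every size `m`):
# on a window where the normalised pivot pencil is Loewner monotone, `det F` has AT MOST ONE root

HONEST FRAMING.  Cell `pub-symmetroid`, seat `val-sym-mdr-p1` (gen 10); helper `--supports` the crux
`Theses.LacunarySymmetroid.MatrixDescartes` (OPEN, on HOLD), NO closure claim.  Pivot currency of conjb-1
(`…CensusPivotDefs`): `F(u) = u^e • J + ∑ₖ u^{dₖ} • Pₖ`, `J` real symmetric, `Pₖ ⪰ 0`, pivot index `≤ 1`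
(`J + W Wᵀ ⪰ 0` for ONE column `W`).

The cell's window toolkit (`…RegimeWindowsToolkit`, `…PivotValley`: val-sym-mdr-p2) proves: on a window of `u > 0` where the
NORMALISED pencil `u ↦ F(u)/u^e` is Loewner non-increasing (resp. non-decreasing) — e.g. the two flanks of the PIVOT-VALLEY LAW,
certified by cross-pivot dominance — `det F` has at most `m` (= `card ι`) distinct roots.  This file proves the INDEX-ONE
sharpening, for EVERY size `m`:

* `card_roots_window_le_one_of_psdRoots_anti` / `…_mono` (core, any real symmetric `J`, any size): if on an order-connected
  window `𝒲 ⊆ (0, ∞)` every root of `det F` is a PSD point of `F` and `u ↦ F(u)/u^e` is Loewner non-increasing (resp.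
  non-decreasing) there — stated division-free as `t^e • F(s) − s^e • F(t) ⪰ 0` for `s ≤ t` in `𝒲` — then `det F` has AT MOST
  ONE root in `𝒲` (when `det F ≡ 0` the census counts no root at all).  PROOF: two PSD-singular points `a < b` on a monotone window force
  the kernel vector of `F(a)` (resp. `F(b)`) to be isotropic for the PSD matrices `F(u)`, `a ≤ u ≤ b`, hence in their kernel
  (Mathlib `Matrix.PosSemidef.dotProduct_mulVec_zero_iff`), so `det F` vanishes on `[a, b]` and is the zero polynomial.
* `card_roots_window_le_one_of_indexOne_anti` / `…_mono` (every `m`, `det J ≠ 0`, index `≤ 1`): the PSD-root hypothesis is the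
  tree's `Pivot.IndexOneRoots.posSemidef_at_posRoot` (val-sym-mdr-p1 g7: at index one EVERY positive root is a PSD point), so
  the conclusion holds outright: **≤ 1 root per Loewner-monotone window** (`[x₁, x₂]`, and the flank forms `(0, x₁]`
  non-increasing / `[x₂, ∞)` non-decreasing: `card_roots_leftFlank_le_one_of_indexOne`, `card_roots_rightFlank_le_one_of_indexOne`).
* `card_roots_window_le_one_of_index_lt_two_anti` / `…_mono` (`m = 2`, any `J` of index `< 2`, no determinant condition): the
  same via `Pivot.IndexRoots.posSemidef_at_posRoot_of_index_lt_two` (g6).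

Consequence for the `m = 2` programme (paper, not restated as a theorem): with the PIVOT-VALLEY certificates the two flanks of an
index-one pencil carry ≤ 1 root each, so `Z₊ ≤ 2 + #{roots in the valley}`; the conjectured row `(2,K) ≤ 2K` would therefore FOLLOW from
«≤ 2K − 2 roots in the valley» — but that stronger statement is FALSE: on the cell's `K = 4` eight-root witness (val-sym-mdr-p1 g5) the
canonical valley (where `∑ₖ (dₖ−e) u^{dₖ} Pₖ` is indefinite) contains all `8 = 2K` roots and both flanks are empty (corrected 2026-08-27,
same seat; the earlier wording «is thus exactly» was wrong).  Nothing here bears on `MatrixDescartes` in its window, on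
`DoorA26`/`DoorA34`, on the cell's registers, or on `VP ≠ VNP`.

[folklore] Loewner order, kernel of a PSD matrix from an isotropic vector (Mathlib), a polynomial with infinitely many roots
vanishes (Mathlib `Polynomial.eq_zero_of_infinite_isRoot`); no single source.
-/

-- `Summit.ValiantsHypothesis.ValiantsHypothesis.…` repeats a component by the D-0017 layout
-- (single-conjunct summit), which the `dupNamespace` linter flags; the name is mandated.
set_option linter.dupNamespace false

namespace Summit.ValiantsHypothesis.ValiantsHypothesis.Theorems.LacunarySymmetroidMatrixDescartes.Pivot.MonotoneWindow

open Polynomial Matrix Finset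
open scoped BigOperators

variable {m K : ℕ}

/-! ### 1. Tools -/

/-- The quadratic form of a scalar combination `α • A − β • B` at `v`. [folklore] -/
theorem quadForm_smul_sub_smul (A B : Matrix (Fin m) (Fin m) ℝ) (α β : ℝ) (v : Fin m → ℝ) :
    v ⬝ᵥ ((α • A - β • B) *ᵥ v) = α * (v ⬝ᵥ (A *ᵥ v)) - β * (v ⬝ᵥ (B *ᵥ v)) := by
  rw [Matrix.sub_mulVec, dotProduct_sub, Matrix.smul_mulVec, Matrix.smul_mulVec, dotProduct_smul,
    dotProduct_smul, smul_eq_mul, smul_eq_mul]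

/-- A real quadratic-form inequality read off a `PosSemidef` difference of scalar multiples:
`α • A − β • B ⪰ 0 ⇒ β · vᵀBv ≤ α · vᵀAv`. [folklore] -/
theorem quadForm_le_of_posSemidef_smul_sub_smul {A B : Matrix (Fin m) (Fin m) ℝ} {α β : ℝ}
    (h : (α • A - β • B).PosSemidef) (v : Fin m → ℝ) :
    β * (v ⬝ᵥ (B *ᵥ v)) ≤ α * (v ⬝ᵥ (A *ᵥ v)) := by
  have h0 := h.dotProduct_mulVec_nonneg v
  rw [star_trivial, quadForm_smul_sub_smul] at h0
  linarith

/-- If `det` of the evaluated pencil vanishes at every point of a non-trivial interval, the determinant POLYNOMIAL is zero.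
[folklore] -/
theorem det_pencil_eq_zero_of_det_eval_eq_zero_on_Icc (e : ℕ) (d : Fin K → ℕ) (J : Matrix (Fin m) (Fin m) ℝ)
    (P : Fin K → Matrix (Fin m) (Fin m) ℝ) {a b : ℝ} (hab : a < b)
    (h : ∀ u, a ≤ u → u ≤ b → (u ^ e • J + ∑ k, u ^ d k • P k).det = 0) :
    Matrix.det (((X : ℝ[X]) ^ e) • J.map Polynomial.C + ∑ k, ((X : ℝ[X]) ^ d k) • (P k).map Polynomial.C) = 0 := by
  refine Polynomial.eq_zero_of_infinite_isRoot _ ((Set.Icc_infinite hab).mono fun u hu => ?_)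
  change Polynomial.IsRoot _ u
  rw [Polynomial.IsRoot.def, eval_det_pivot]
  exact h u hu.1 hu.2

/-! ### 2. The core: PSD roots on a monotone window -/

/-- **Core, non-increasing window.**  `J` any real symmetric matrix, `Pₖ ⪰ 0`.  Suppose that on an order-connected window `𝒲 ⊆ (0, ∞)`
every root of `det F` is a PSD point of `F(u) = u^e • J + ∑ u^{dₖ} • Pₖ` and that `u ↦ F(u)/u^e` is Loewner non-increasing there
(`t^e • F(s) − s^e • F(t) ⪰ 0` for `s ≤ t` in `𝒲`).  Then `det F` has at most one root in `𝒲`. [folklore] -/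
theorem card_roots_window_le_one_of_psdRoots_anti (e : ℕ) (d : Fin K → ℕ) (J : Matrix (Fin m) (Fin m) ℝ)
    (P : Fin K → Matrix (Fin m) (Fin m) ℝ) (hJ : J.IsSymm) (hP : ∀ k, (P k).PosSemidef) (𝒲 : Set ℝ)
    [DecidablePred (· ∈ 𝒲)] (h𝒲 : 𝒲.OrdConnected) (hpos : ∀ u ∈ 𝒲, 0 < u)
    (hpsd : ∀ u ∈ 𝒲,
      u ∈ (Matrix.det (((X : ℝ[X]) ^ e) • J.map Polynomial.C + ∑ k, ((X : ℝ[X]) ^ d k) • (P k).map Polynomial.C)).roots →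
      (u ^ e • J + ∑ k, u ^ d k • P k).PosSemidef)
    (hanti : ∀ s ∈ 𝒲, ∀ t ∈ 𝒲, s ≤ t →
      (t ^ e • (s ^ e • J + ∑ k, s ^ d k • P k) - s ^ e • (t ^ e • J + ∑ k, t ^ d k • P k)).PosSemidef) :
    ((Matrix.det (((X : ℝ[X]) ^ e) • J.map Polynomial.C
        + ∑ k, ((X : ℝ[X]) ^ d k) • (P k).map Polynomial.C)).roots.toFinset.filter
          (fun u => u ∈ 𝒲)).card ≤ 1 := by
  classical
  set p := Matrix.det (((X : ℝ[X]) ^ e) • J.map Polynomial.C + ∑ k, ((X : ℝ[X]) ^ d k) • (P k).map Polynomial.C)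
    with hp
  by_cases hp0 : p = 0
  · rw [hp0, Polynomial.roots_zero]; simp
  refine Finset.card_le_one.mpr fun a ha b hb => ?_
  simp only [Finset.mem_filter, Multiset.mem_toFinset] at ha hb
  -- the symmetric core: a root `a'` to the left of a root `b'` in the window forces `p = 0`
  have key : ∀ a' ∈ 𝒲, ∀ b' ∈ 𝒲, a' < b' → a' ∈ p.roots → b' ∈ p.roots → False := by
    intro a' ha' b' hb' hab hra hrb
    have ha'0 : 0 < a' := hpos a' ha'
    have hFa := hpsd a' ha' hra
    have hFb := hpsd b' hb' hrb
    -- kernel vector of `F(a')`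
    have hdeta : (a' ^ e • J + ∑ k, a' ^ d k • P k).det = 0 := by
      have h := (Polynomial.mem_roots hp0).1 hra; rwa [Polynomial.IsRoot.def, hp, eval_det_pivot] at h
    obtain ⟨v, hv0, hva⟩ := Matrix.exists_mulVec_eq_zero_iff.mpr hdeta
    refine hp0 (det_pencil_eq_zero_of_det_eval_eq_zero_on_Icc e d J P hab fun u hau hub => ?_)
    have hu𝒲 : u ∈ 𝒲 := h𝒲.out ha' hb' ⟨hau, hub⟩
    have hu0 : 0 < u := hpos u hu𝒲
    -- `F(u)` is PSD: `b'^e • F(u) ⪰ u^e • F(b') ⪰ 0`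
    have h2 := hanti u hu𝒲 b' hb' hub
    have hFu : (u ^ e • J + ∑ k, u ^ d k • P k).PosSemidef := by
      refine Matrix.PosSemidef.of_dotProduct_mulVec_nonneg (Convexity.isHermitian_eval_pencil e d J P hJ hP u) fun w => ?_
      rw [star_trivial]
      have hw := quadForm_le_of_posSemidef_smul_sub_smul h2 w
      have hwb : 0 ≤ w ⬝ᵥ ((b' ^ e • J + ∑ k, b' ^ d k • P k) *ᵥ w) := by
        simpa using hFb.dotProduct_mulVec_nonneg w
      have hbe : 0 < b' ^ e := pow_pos (ha'0.trans hab) e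
      nlinarith [pow_nonneg hu0.le e]
    -- the kernel vector `v` of `F(a')` is isotropic for `F(u)`
    have h1 := hanti a' ha' u hu𝒲 hau
    have hq_le : v ⬝ᵥ ((u ^ e • J + ∑ k, u ^ d k • P k) *ᵥ v) ≤ 0 := by
      have hv := quadForm_le_of_posSemidef_smul_sub_smul h1 v
      rw [hva, dotProduct_zero, mul_zero] at hv
      have hae : 0 < a' ^ e := pow_pos ha'0 e
      nlinarith
    have hq_ge : 0 ≤ v ⬝ᵥ ((u ^ e • J + ∑ k, u ^ d k • P k) *ᵥ v) := by
      simpa using hFu.dotProduct_mulVec_nonneg v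
    have hq : v ⬝ᵥ ((u ^ e • J + ∑ k, u ^ d k • P k) *ᵥ v) = 0 := le_antisymm hq_le hq_ge
    have hker : (u ^ e • J + ∑ k, u ^ d k • P k) *ᵥ v = 0 := by
      have hiff := hFu.dotProduct_mulVec_zero_iff v
      rw [star_trivial] at hiff
      exact hiff.1 hq
    exact Matrix.exists_mulVec_eq_zero_iff.mp ⟨v, hv0, hker⟩
  rcases lt_trichotomy a b with hlt | heq | hgt
  · exact (key a ha.2 b hb.2 hlt ha.1 hb.1).elim
  · exact heq
  · exact (key b hb.2 a ha.2 hgt hb.1 ha.1).elim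

/-- **Core, non-decreasing window** (`s^e • F(t) − t^e • F(s) ⪰ 0` for `s ≤ t` in `𝒲`): same conclusion, with the kernel
vector taken at the RIGHT root. [folklore] -/
theorem card_roots_window_le_one_of_psdRoots_mono (e : ℕ) (d : Fin K → ℕ) (J : Matrix (Fin m) (Fin m) ℝ)
    (P : Fin K → Matrix (Fin m) (Fin m) ℝ) (hJ : J.IsSymm) (hP : ∀ k, (P k).PosSemidef) (𝒲 : Set ℝ)
    [DecidablePred (· ∈ 𝒲)] (h𝒲 : 𝒲.OrdConnected) (hpos : ∀ u ∈ 𝒲, 0 < u)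
    (hpsd : ∀ u ∈ 𝒲,
      u ∈ (Matrix.det (((X : ℝ[X]) ^ e) • J.map Polynomial.C + ∑ k, ((X : ℝ[X]) ^ d k) • (P k).map Polynomial.C)).roots →
      (u ^ e • J + ∑ k, u ^ d k • P k).PosSemidef)
    (hmono : ∀ s ∈ 𝒲, ∀ t ∈ 𝒲, s ≤ t →
      (s ^ e • (t ^ e • J + ∑ k, t ^ d k • P k) - t ^ e • (s ^ e • J + ∑ k, s ^ d k • P k)).PosSemidef) :
    ((Matrix.det (((X : ℝ[X]) ^ e) • J.map Polynomial.C
        + ∑ k, ((X : ℝ[X]) ^ d k) • (P k).map Polynomial.C)).roots.toFinset.filter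
          (fun u => u ∈ 𝒲)).card ≤ 1 := by
  classical
  set p := Matrix.det (((X : ℝ[X]) ^ e) • J.map Polynomial.C + ∑ k, ((X : ℝ[X]) ^ d k) • (P k).map Polynomial.C)
    with hp
  by_cases hp0 : p = 0
  · rw [hp0, Polynomial.roots_zero]; simp
  refine Finset.card_le_one.mpr fun a ha b hb => ?_
  simp only [Finset.mem_filter, Multiset.mem_toFinset] at ha hb
  have key : ∀ a' ∈ 𝒲, ∀ b' ∈ 𝒲, a' < b' → a' ∈ p.roots → b' ∈ p.roots → False := by
    intro a' ha' b' hb' hab hra hrb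
    have ha'0 : 0 < a' := hpos a' ha'
    have hb'0 : 0 < b' := ha'0.trans hab
    have hFa := hpsd a' ha' hra
    have hFb := hpsd b' hb' hrb
    -- kernel vector of `F(b')`
    have hdetb : (b' ^ e • J + ∑ k, b' ^ d k • P k).det = 0 := by
      have h := (Polynomial.mem_roots hp0).1 hrb; rwa [Polynomial.IsRoot.def, hp, eval_det_pivot] at h
    obtain ⟨v, hv0, hvb⟩ := Matrix.exists_mulVec_eq_zero_iff.mpr hdetb
    refine hp0 (det_pencil_eq_zero_of_det_eval_eq_zero_on_Icc e d J P hab fun u hau hub => ?_)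
    have hu𝒲 : u ∈ 𝒲 := h𝒲.out ha' hb' ⟨hau, hub⟩
    have hu0 : 0 < u := hpos u hu𝒲
    -- `F(u)` is PSD: `a'^e • F(u) ⪰ u^e • F(a') ⪰ 0`
    have h1 := hmono a' ha' u hu𝒲 hau
    have hFu : (u ^ e • J + ∑ k, u ^ d k • P k).PosSemidef := by
      refine Matrix.PosSemidef.of_dotProduct_mulVec_nonneg (Convexity.isHermitian_eval_pencil e d J P hJ hP u) fun w => ?_
      rw [star_trivial]
      have hw := quadForm_le_of_posSemidef_smul_sub_smul h1 w
      have hwa : 0 ≤ w ⬝ᵥ ((a' ^ e • J + ∑ k, a' ^ d k • P k) *ᵥ w) := by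
        simpa using hFa.dotProduct_mulVec_nonneg w
      have hae : 0 < a' ^ e := pow_pos ha'0 e
      nlinarith [pow_nonneg hu0.le e]
    -- the kernel vector `v` of `F(b')` is isotropic for `F(u)`
    have h2 := hmono u hu𝒲 b' hb' hub
    have hq_le : v ⬝ᵥ ((u ^ e • J + ∑ k, u ^ d k • P k) *ᵥ v) ≤ 0 := by
      have hv := quadForm_le_of_posSemidef_smul_sub_smul h2 v
      rw [hvb, dotProduct_zero, mul_zero] at hv
      have hbe : 0 < b' ^ e := pow_pos hb'0 e
      nlinarith
    have hq_ge : 0 ≤ v ⬝ᵥ ((u ^ e • J + ∑ k, u ^ d k • P k) *ᵥ v) := by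
      simpa using hFu.dotProduct_mulVec_nonneg v
    have hq : v ⬝ᵥ ((u ^ e • J + ∑ k, u ^ d k • P k) *ᵥ v) = 0 := le_antisymm hq_le hq_ge
    have hker : (u ^ e • J + ∑ k, u ^ d k • P k) *ᵥ v = 0 := by
      have hiff := hFu.dotProduct_mulVec_zero_iff v
      rw [star_trivial] at hiff
      exact hiff.1 hq
    exact Matrix.exists_mulVec_eq_zero_iff.mp ⟨v, hv0, hker⟩
  rcases lt_trichotomy a b with hlt | heq | hgt
  · exact (key a ha.2 b hb.2 hlt ha.1 hb.1).elim
  · exact heq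
  · exact (key b hb.2 a ha.2 hgt hb.1 ha.1).elim

/-! ### 3. Index one, every size `m` -/

/-- **INDEX-ONE MONOTONE-WINDOW LAW (non-increasing), every `m`.**  `J` real symmetric with `det J ≠ 0` and `J + W Wᵀ ⪰ 0` for
one column `W` (pivot index `≤ 1`), `Pₖ ⪰ 0`.  If `u ↦ F(u)/u^e` is Loewner non-increasing on `[x₁, x₂]` (`0 < x₁`), then `det F`
has at most ONE root there — sharpening the toolkit's `≤ m` (`…RegimeWindowsToolkit`) at index one. [folklore] -/
theorem card_roots_window_le_one_of_indexOne_anti (e : ℕ) (d : Fin K → ℕ) (J : Matrix (Fin m) (Fin m) ℝ)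
    (P : Fin K → Matrix (Fin m) (Fin m) ℝ) (hJ : J.IsSymm) (hJdet : J.det ≠ 0) (W : Matrix (Fin m) (Fin 1) ℝ)
    (hW : (J + W * Wᵀ).PosSemidef) (hP : ∀ k, (P k).PosSemidef) {x₁ x₂ : ℝ} (hx₁ : 0 < x₁)
    (hanti : ∀ s t : ℝ, x₁ ≤ s → s ≤ t → t ≤ x₂ →
      (t ^ e • (s ^ e • J + ∑ k, s ^ d k • P k) - s ^ e • (t ^ e • J + ∑ k, t ^ d k • P k)).PosSemidef) :
    ((Matrix.det (((X : ℝ[X]) ^ e) • J.map Polynomial.C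
        + ∑ k, ((X : ℝ[X]) ^ d k) • (P k).map Polynomial.C)).roots.toFinset.filter
          (fun u => x₁ ≤ u ∧ u ≤ x₂)).card ≤ 1 := by
  classical
  have h := card_roots_window_le_one_of_psdRoots_anti e d J P hJ hP (Set.Icc x₁ x₂) Set.ordConnected_Icc
    (fun _ hu => hx₁.trans_le hu.1)
    (fun _ hu hr => IndexOneRoots.posSemidef_at_posRoot e d J P hJ hJdet W hW hP (hx₁.trans_le hu.1)
      ((Polynomial.mem_roots'.1 hr).2))
    (fun s hs t ht hst => hanti s t hs.1 hst ht.2)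
  simpa only [Set.mem_Icc] using h

/-- **INDEX-ONE MONOTONE-WINDOW LAW (non-decreasing), every `m`.** [folklore] -/
theorem card_roots_window_le_one_of_indexOne_mono (e : ℕ) (d : Fin K → ℕ) (J : Matrix (Fin m) (Fin m) ℝ)
    (P : Fin K → Matrix (Fin m) (Fin m) ℝ) (hJ : J.IsSymm) (hJdet : J.det ≠ 0) (W : Matrix (Fin m) (Fin 1) ℝ)
    (hW : (J + W * Wᵀ).PosSemidef) (hP : ∀ k, (P k).PosSemidef) {x₁ x₂ : ℝ} (hx₁ : 0 < x₁)
    (hmono : ∀ s t : ℝ, x₁ ≤ s → s ≤ t → t ≤ x₂ →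
      (s ^ e • (t ^ e • J + ∑ k, t ^ d k • P k) - t ^ e • (s ^ e • J + ∑ k, s ^ d k • P k)).PosSemidef) :
    ((Matrix.det (((X : ℝ[X]) ^ e) • J.map Polynomial.C
        + ∑ k, ((X : ℝ[X]) ^ d k) • (P k).map Polynomial.C)).roots.toFinset.filter
          (fun u => x₁ ≤ u ∧ u ≤ x₂)).card ≤ 1 := by
  classical
  have h := card_roots_window_le_one_of_psdRoots_mono e d J P hJ hP (Set.Icc x₁ x₂) Set.ordConnected_Icc
    (fun _ hu => hx₁.trans_le hu.1)
    (fun _ hu hr => IndexOneRoots.posSemidef_at_posRoot e d J P hJ hJdet W hW hP (hx₁.trans_le hu.1)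
      ((Polynomial.mem_roots'.1 hr).2))
    (fun s hs t ht hst => hmono s t hs.1 hst ht.2)
  simpa only [Set.mem_Icc] using h

/-- **Left flank, index one, every `m`**: if `u ↦ F(u)/u^e` is Loewner non-increasing on `(0, x₁]`, then `det F` has at most one
root in `(0, x₁]` (the left flank of the pivot-valley law carries ≤ 1 root at index one, versus ≤ `m` in general). [folklore] -/
theorem card_roots_leftFlank_le_one_of_indexOne (e : ℕ) (d : Fin K → ℕ) (J : Matrix (Fin m) (Fin m) ℝ)
    (P : Fin K → Matrix (Fin m) (Fin m) ℝ) (hJ : J.IsSymm) (hJdet : J.det ≠ 0) (W : Matrix (Fin m) (Fin 1) ℝ)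
    (hW : (J + W * Wᵀ).PosSemidef) (hP : ∀ k, (P k).PosSemidef) (x₁ : ℝ)
    (hanti : ∀ s t : ℝ, 0 < s → s ≤ t → t ≤ x₁ →
      (t ^ e • (s ^ e • J + ∑ k, s ^ d k • P k) - s ^ e • (t ^ e • J + ∑ k, t ^ d k • P k)).PosSemidef) :
    ((Matrix.det (((X : ℝ[X]) ^ e) • J.map Polynomial.C
        + ∑ k, ((X : ℝ[X]) ^ d k) • (P k).map Polynomial.C)).roots.toFinset.filter
          (fun u => 0 < u ∧ u ≤ x₁)).card ≤ 1 := by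
  classical
  have h := card_roots_window_le_one_of_psdRoots_anti e d J P hJ hP (Set.Ioc 0 x₁) Set.ordConnected_Ioc
    (fun _ hu => hu.1)
    (fun _ hu hr => IndexOneRoots.posSemidef_at_posRoot e d J P hJ hJdet W hW hP hu.1
      ((Polynomial.mem_roots'.1 hr).2))
    (fun s hs t ht hst => hanti s t hs.1 hst ht.2)
  simpa only [Set.mem_Ioc] using h

/-- **Right flank, index one, every `m`**: if `u ↦ F(u)/u^e` is Loewner non-decreasing on `[x₂, ∞)` (`0 < x₂`), then `det F` has at
most one root in `[x₂, ∞)`. [folklore] -/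
theorem card_roots_rightFlank_le_one_of_indexOne (e : ℕ) (d : Fin K → ℕ) (J : Matrix (Fin m) (Fin m) ℝ)
    (P : Fin K → Matrix (Fin m) (Fin m) ℝ) (hJ : J.IsSymm) (hJdet : J.det ≠ 0) (W : Matrix (Fin m) (Fin 1) ℝ)
    (hW : (J + W * Wᵀ).PosSemidef) (hP : ∀ k, (P k).PosSemidef) {x₂ : ℝ} (hx₂ : 0 < x₂)
    (hmono : ∀ s t : ℝ, x₂ ≤ s → s ≤ t →
      (s ^ e • (t ^ e • J + ∑ k, t ^ d k • P k) - t ^ e • (s ^ e • J + ∑ k, s ^ d k • P k)).PosSemidef) :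
    ((Matrix.det (((X : ℝ[X]) ^ e) • J.map Polynomial.C
        + ∑ k, ((X : ℝ[X]) ^ d k) • (P k).map Polynomial.C)).roots.toFinset.filter
          (fun u => x₂ ≤ u)).card ≤ 1 := by
  classical
  have h := card_roots_window_le_one_of_psdRoots_mono e d J P hJ hP (Set.Ici x₂) Set.ordConnected_Ici
    (fun _ hu => hx₂.trans_le hu)
    (fun _ hu hr => IndexOneRoots.posSemidef_at_posRoot e d J P hJ hJdet W hW hP (hx₂.trans_le hu)
      ((Polynomial.mem_roots'.1 hr).2))
    (fun s hs t _ hst => hmono s t hs hst)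
  simpa only [Set.mem_Ici] using h

/-! ### 4. Size two, any pivot of index `< 2` (no determinant condition) -/

/-- **`m = 2`, index `< 2`, non-increasing window**: at most one root (the PSD-root lemma is the tree's
`Pivot.IndexRoots.posSemidef_at_posRoot_of_index_lt_two`, which needs no `det J ≠ 0`). [folklore] -/
theorem card_roots_window_le_one_of_index_lt_two_anti {q : ℕ} (e : ℕ) (d : Fin K → ℕ) (J : Matrix (Fin 2) (Fin 2) ℝ)
    (P : Fin K → Matrix (Fin 2) (Fin 2) ℝ) (hJ : J.IsSymm) (hP : ∀ k, (P k).PosSemidef) (W : Matrix (Fin 2) (Fin q) ℝ)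
    (hq : q < 2) (hW : (J + W * Wᵀ).PosSemidef) {x₁ x₂ : ℝ} (hx₁ : 0 < x₁)
    (hanti : ∀ s t : ℝ, x₁ ≤ s → s ≤ t → t ≤ x₂ →
      (t ^ e • (s ^ e • J + ∑ k, s ^ d k • P k) - s ^ e • (t ^ e • J + ∑ k, t ^ d k • P k)).PosSemidef) :
    ((Matrix.det (((X : ℝ[X]) ^ e) • J.map Polynomial.C
        + ∑ k, ((X : ℝ[X]) ^ d k) • (P k).map Polynomial.C)).roots.toFinset.filter
          (fun u => x₁ ≤ u ∧ u ≤ x₂)).card ≤ 1 := by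
  classical
  have h := card_roots_window_le_one_of_psdRoots_anti e d J P hJ hP (Set.Icc x₁ x₂) Set.ordConnected_Icc
    (fun _ hu => hx₁.trans_le hu.1)
    (fun _ hu hr => IndexRoots.posSemidef_at_posRoot_of_index_lt_two e d J P hJ hP W hq hW (hx₁.trans_le hu.1) hr)
    (fun s hs t ht hst => hanti s t hs.1 hst ht.2)
  simpa only [Set.mem_Icc] using h

/-- **`m = 2`, index `< 2`, non-decreasing window**: at most one root. [folklore] -/
theorem card_roots_window_le_one_of_index_lt_two_mono {q : ℕ} (e : ℕ) (d : Fin K → ℕ) (J : Matrix (Fin 2) (Fin 2) ℝ)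
    (P : Fin K → Matrix (Fin 2) (Fin 2) ℝ) (hJ : J.IsSymm) (hP : ∀ k, (P k).PosSemidef) (W : Matrix (Fin 2) (Fin q) ℝ)
    (hq : q < 2) (hW : (J + W * Wᵀ).PosSemidef) {x₁ x₂ : ℝ} (hx₁ : 0 < x₁)
    (hmono : ∀ s t : ℝ, x₁ ≤ s → s ≤ t → t ≤ x₂ →
      (s ^ e • (t ^ e • J + ∑ k, t ^ d k • P k) - t ^ e • (s ^ e • J + ∑ k, s ^ d k • P k)).PosSemidef) :
    ((Matrix.det (((X : ℝ[X]) ^ e) • J.map Polynomial.C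
        + ∑ k, ((X : ℝ[X]) ^ d k) • (P k).map Polynomial.C)).roots.toFinset.filter
          (fun u => x₁ ≤ u ∧ u ≤ x₂)).card ≤ 1 := by
  classical
  have h := card_roots_window_le_one_of_psdRoots_mono e d J P hJ hP (Set.Icc x₁ x₂) Set.ordConnected_Icc
    (fun _ hu => hx₁.trans_le hu.1)
    (fun _ hu hr => IndexRoots.posSemidef_at_posRoot_of_index_lt_two e d J P hJ hP W hq hW (hx₁.trans_le hu.1) hr)
    (fun s hs t ht hst => hmono s t hs.1 hst ht.2)
  simpa only [Set.mem_Icc] using h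

end Summit.ValiantsHypothesis.ValiantsHypothesis.Theorems.LacunarySymmetroidMatrixDescartes.Pivot.MonotoneWindow
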